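import Mathlib.InformationTheory.KullbackLeibler.Basic
import Mathlib.MeasureTheory.Measure.GiryMonad
import Mathlib.Analysis.Calculus.FDeriv.Pi
import Mathlib.Analysis.Calculus.Deriv.Prod
import Mathlib.Analysis.Calculus.Deriv.Shift
import Mathlib.Analysis.Calculus.FDeriv.Measurable
import Literature.MathematicalPhysics.KineticTheory.InfiniteChainInvariantStates
import HarnessLib

/-!
# Calculus of local observables of the infinite oscillator chain: box formula, shift covariance, momentum reversal

Topic `Literature/MathematicalPhysics/KineticTheory`; definition request
`defn-InfiniteChainLocalObservables` (wanted by `stmt-AtomisticToContinuum-2739` and the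
`FouriersLaw` routes of `AtomisticToContinuum`). The VOCABULARY of Bernardin 2014, §1.1
(Definition 1 and its footnote) for the infinite pinned chain `P : OscillatorChain` on
`ChainConfig = ℤ → ℝ × ℝ` — `boxRestrict`, `IsLocalTestFunction` (`C₀¹`), `partialQZ`, `partialPZ`,
`liouvilleZ P` (`𝒜f = ∑_x (p_x ∂_{q_x} f + F_x ∂_{p_x} f)`), `shift`, `IsShiftInvariant`,
`IsTimeInvariant P` (`∫ 𝒜f dν = 0` on `C₀¹`), `boxRestrictAt`, `boxMarginal`, `IsRegular P`,
`IsGibbsMixture P`, `IsMacroErgodic P` — lives fact-free in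
`Literature.MathematicalPhysics.KineticTheory.InfiniteChainInvariantStates` (namespace
`Literature.MathematicalPhysics.KineticTheory.HeatConduction`, chain `P` explicit), re-homed there
from the barrier entry `Literature/Barriers/AtomisticToContinuum/MacroErgodicityHypothesis.lean`.
This module is the proved CALCULUS on top of it, in the same namespace; it imports only that
module (hence `InfiniteChainDynamics`) and Mathlib, so its import cone carries no open named fact.

History (2026-08-15): the first accepted version of this file (p46194) declared its own copy of
the vocabulary in a sub-namespace `…HeatConduction.InfiniteChain`; it was rebased the same day
onto `InfiniteChainInvariantStates` (accepted a few minutes later with the directory-aligned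
names), before any file imported it, because (i) one body per notion is wanted and (ii)
`Literature.MathematicalPhysics.KineticTheory.HeatConduction.InfiniteChain` is the namespace of
the site-dependent chain STRUCTURE `InfiniteChain` of `HarmonicHostWithCell.lean`. A third copy
with FFL-style names (`ChainConfig.boxRestrict`, …, `OscillatorChain.liouville`,
`OscillatorChain.IsLiouvilleStationary`, plus the new `OscillatorChain.IsRegularFinVol`) is
`InfiniteChainStates.lean`; its bodies are the same token for token, so every result below
transfers to those names by `exact` (definitional unfolding); this file does not import it.

## Sources

* Bernardin 2014 (arXiv:1407.7023), §1.1, p. 3: "A function `f : X → ℝ` is said to be local if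
  it depends of `ξ` only through the coordinates `{ξ_x ; x ∈ Λ_f}`, `Λ_f` being a finite box of
  `ℤ`. We also introduce the sets `C₀ᵏ(X)`, `k ≥ 1` …, of bounded local functions on `X` which
  are differentiable up to order `k` with bounded partial derivatives"; the generator `𝒜` is the
  Liouville operator `∑_x {∂_{p_x}ℋ ∂_{q_x} - ∂_{q_x}ℋ ∂_{p_x}}` "in infinite volume, i.e.
  replacing `Λ_N` by `ℤᵈ`". p. 4: "`ν` is said to be `μ`-regular if for any finite box `Λ ⊂ ℤᵈ`
  … the relative entropy of `ν|_Λ` w.r.t. `μ|_Λ` is bounded above by `C|Λ|`". p. 5, Definition 1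
  (Macro-Ergodicity) and its footnote ("`ν` is time invariant for the infinite dynamics if and only
  if `∫ 𝒜f dν = 0` for any `f ∈ C₀¹(Ω̃)`").
* Fritz–Funaki–Lebowitz 1994, §2: reflection symmetry (RS) `p_k ↦ -p_k` of stationary states of
  the deterministic chain (their Thm 2.2) — the momentum reversal `momentumReversalZ` below.
* Lanford–Lebowitz–Lieb 1977, §2 and §4 (the model, `InfiniteChainDynamics`);
  Bonetto–Lebowitz–Rey-Bellet 2000, §5.2 eq. (23) (the bond current `bondCurrentZ`).

## Contents (everything proved; two new definitions, both measurable equivalences)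

* `shiftEquiv : ChainConfig ≃ᵐ ChainConfig` (`⇑shiftEquiv = shift`) and the **momentum reversal**
  `momentumReversalZ : ChainConfig ≃ᵐ ChainConfig`, `(Rσ)_x = (q_x, -p_x)` (infinite-chain
  analogue of the finite-chain `momentumReversal N` of `LangevinChainGibbs`).
* Local test functions: re-boxing on any box (`isLocalTestFunction_comp_boxRestrictAt`,
  `IsLocalTestFunction.exists_rep`), closure under `+`, scalars, `shift`, `momentumReversalZ`;
  measurability, boundedness, integrability.
* **Box formula**: `liouvilleZ_comp_boxRestrictAt` / `liouvilleZ_comp_boxRestrict` — for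
  `f = g ∘ box`, `𝒜f(σ) = ∑_i (p_{a+i} Dg(e_i^q) + F_{a+i} Dg(e_i^p))`; Hamilton's equations
  `liouvilleZ_position : 𝒜q_x = p_x`, `liouvilleZ_momentum : 𝒜p_x = F_x`; measurability of
  `F_x`, `j_x`, `𝒜f` (every chain) and the growth bound `|𝒜f| ≤ M' ∑_{|x|≤R} (|p_x| + |F_x|)`;
  linearity and the Leibniz rule for `𝒜` on `C₀¹`
  (`IsLocalTestFunction.liouvilleZ_add/_const_mul/_neg/_mul`, `IsLocalTestFunction.mul`);
  non-vacuity `isTimeInvariant_dirac_rest`, `isShiftInvariant_dirac_rest`.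
* **Shift covariance**: `liouvilleZ_comp_shift : 𝒜(f ∘ τ) = (𝒜f) ∘ τ`, `force_shift`,
  `bondCurrentZ_shift`, `IsTimeInvariant.map_shift`, `IsShiftInvariant.integral_comp_shift`.
* **Momentum-reversal calculus**: `liouvilleZ_comp_momentumReversalZ : 𝒜(f ∘ R) = -(𝒜f) ∘ R`
  (no differentiability needed), `bondCurrentZ_momentumReversalZ` (odd), `force_momentumReversalZ`,
  `chainPotential_momentumReversalZ`, `chainSpecification_momentumReversalZ` (equivariance of the
  finite-volume Gibbs distributions), `OscillatorChain.IsChainGibbsMeasure.map_momentumReversalZ`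
  (Gibbs states go to Gibbs states), `klDiv_map_equiv` (KL divergence invariant under measurable
  equivalences) and the stability of all four hypotheses and of the conclusion of Definition 1
  under `ν ↦ ν ∘ R⁻¹`: `IsShiftInvariant/IsTimeInvariant/IsRegular/IsGibbsMixture.map_momentumReversalZ`,
  `spaceTimeInvariantRegular_map_momentumReversalZ`; an `R`-invariant state has zero mean bond
  current and is stationary on `R`-even test functions for free
  (`integral_bondCurrentZ_eq_zero_of_map_momentumReversalZ_eq`,
  `integral_liouvilleZ_eq_zero_of_map_momentumReversalZ_eq`).

## Design notes

* Everything is stated for a general `P : OscillatorChain` (no smoothness or measurability of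
  `U`, `V` is assumed): the reversal identities need no differentiability
  (`deriv (t ↦ h(-t)) = -(deriv h)(-t)` holds unconditionally), the Gibbs equivariance is a change
  of variables along a MEASURABLE EQUIVALENCE, valid for any tilting function, and derivatives of
  arbitrary real functions are measurable (Mathlib `measurable_deriv`).
* Name hygiene: `StationaryPerturbationClass.lean` (which imports the barrier entry) proves
  `shift_update`, `partialQZ_comp_shift`, `partialPZ_comp_shift`, `measurable_shift`,
  `measurable_boxRestrictAt`, `shift_apply` in this namespace for the barrier's copies of the
  notions; the fact-free versions here therefore carry the names `shift_update_eq`,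
  `partialQZ_comp_shift_apply`, `partialPZ_comp_shift_apply`, `shift_measurable`,
  `boxRestrictAt_measurable`, `boxRestrict_measurable` (and `simp [shift]` unfolds the shift).
* What is NOT here: the barrier (`MacroErgodicityBarrier`, `SectorCondition`) and the open
  `MacroErgodicityHypothesis` stay in the barrier file; no statement about existence of the
  infinite-volume flow (see `InfiniteChainDynamics`).
-/

noncomputable section

open MeasureTheory Filter Topology Set InformationTheory Literature.Probability.LatticeModels
open scoped ENNReal

namespace Literature.MathematicalPhysics.KineticTheory.HeatConduction

/-! ### Measurable equivalences: the shift and the momentum reversal -/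

/-- The shift as a measurable equivalence of `ChainConfig` (inverse `σ ↦ (x ↦ σ (x - 1))`).
[folklore] -/
def shiftEquiv : ChainConfig ≃ᵐ ChainConfig where
  toFun := shift
  invFun σ x := σ (x - 1)
  left_inv σ := by funext x; simp [shift]
  right_inv σ := by funext x; simp [shift]
  measurable_toFun := measurable_pi_lambda _ fun x => measurable_pi_apply (x + 1)
  measurable_invFun := measurable_pi_lambda _ fun x => measurable_pi_apply (x - 1)

/-- **Momentum reversal** `(Rσ)_x = (q_x, -p_x)` of the infinite chain, as a measurable
equivalence (an involution); the reflection symmetry (RS) of Fritz–Funaki–Lebowitz and the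
infinite-volume analogue of `momentumReversal N`. [cite: FritzFunakiLebowitz1994, §2 (RS)] -/
def momentumReversalZ : ChainConfig ≃ᵐ ChainConfig where
  toFun σ x := ((σ x).1, -(σ x).2)
  invFun σ x := ((σ x).1, -(σ x).2)
  left_inv σ := by funext x; simp
  right_inv σ := by funext x; simp
  measurable_toFun := measurable_pi_lambda _ fun x =>
    (measurable_pi_apply x).fst.prodMk (measurable_pi_apply x).snd.neg
  measurable_invFun := measurable_pi_lambda _ fun x =>
    (measurable_pi_apply x).fst.prodMk (measurable_pi_apply x).snd.neg

/-! ### Unfolding lemmas and measurability -/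

/-- [folklore] -/
@[simp] theorem boxRestrict_apply (R : ℕ) (σ : ChainConfig) (i : Fin (2 * R + 1)) :
    boxRestrict R σ i = σ ((i : ℤ) - R) := rfl

/-- [folklore] -/
@[simp] theorem boxRestrictAt_apply (a : ℤ) (n : ℕ) (σ : ChainConfig) (i : Fin (n + 1)) :
    boxRestrictAt a n σ i = σ (a + i) := rfl

/-- [folklore] -/
@[simp] theorem coe_shiftEquiv : ⇑shiftEquiv = shift := rfl

/-- [folklore] -/
@[simp] theorem shiftEquiv_symm_apply (σ : ChainConfig) (x : ℤ) : shiftEquiv.symm σ x = σ (x - 1) := rfl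

/-- [folklore] -/
@[simp] theorem momentumReversalZ_apply (σ : ChainConfig) (x : ℤ) :
    momentumReversalZ σ x = ((σ x).1, -(σ x).2) := rfl

/-- [folklore] -/
@[simp] theorem momentumReversalZ_symm : momentumReversalZ.symm = momentumReversalZ := rfl

/-- `R` is an involution. [folklore] -/
@[simp] theorem momentumReversalZ_momentumReversalZ (σ : ChainConfig) :
    momentumReversalZ (momentumReversalZ σ) = σ := by
  funext x; simp

/-- The centred box `{-R, …, R}` is the box `{a, …, a+n}` with `a = -R`, `n = 2R`. [folklore] -/
theorem boxRestrict_eq_boxRestrictAt (R : ℕ) : boxRestrict R = boxRestrictAt (-(R : ℤ)) (2 * R) := by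
  funext σ i
  simp only [boxRestrict_apply, boxRestrictAt_apply]
  congr 1
  ring

/-- [folklore] -/
@[fun_prop]
theorem boxRestrictAt_measurable (a : ℤ) (n : ℕ) : Measurable (boxRestrictAt a n) :=
  measurable_pi_lambda _ fun i => measurable_pi_apply (a + i)

/-- [folklore] -/
@[fun_prop]
theorem boxRestrict_measurable (R : ℕ) : Measurable (boxRestrict R) :=
  measurable_pi_lambda _ fun i => measurable_pi_apply ((i : ℤ) - R)

/-- [folklore] -/
@[fun_prop]
theorem shift_measurable : Measurable shift := shiftEquiv.measurable

/-- The box marginal of a probability measure is a probability measure. [folklore] -/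
instance isProbabilityMeasure_boxMarginal (a : ℤ) (n : ℕ) (ν : Measure ChainConfig)
    [IsProbabilityMeasure ν] : IsProbabilityMeasure (boxMarginal a n ν) :=
  Measure.isProbabilityMeasure_map (boxRestrictAt_measurable a n).aemeasurable

/-- The box marginal of a finite measure is finite. [folklore] -/
instance isFiniteMeasure_boxMarginal (a : ℤ) (n : ℕ) (ν : Measure ChainConfig)
    [IsFiniteMeasure ν] : IsFiniteMeasure (boxMarginal a n ν) := by
  unfold boxMarginal; infer_instance

/-- Integrals of shifted observables against a shift-invariant measure (no measurability needed:
change of variables along the measurable equivalence `shiftEquiv`). [folklore] -/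
theorem IsShiftInvariant.integral_comp_shift {ν : Measure ChainConfig} (hν : IsShiftInvariant ν)
    (f : ChainConfig → ℝ) : ∫ σ, f (shift σ) ∂ν = ∫ σ, f σ ∂ν := by
  have h := integral_map_equiv shiftEquiv f (μ := ν)
  rw [coe_shiftEquiv, hν] at h
  exact h.symm

/-- Integrability of shifted observables against a shift-invariant measure. [folklore] -/
theorem IsShiftInvariant.integrable_comp_shift_iff {ν : Measure ChainConfig} (hν : IsShiftInvariant ν)
    (f : ChainConfig → ℝ) : Integrable (f ∘ shift) ν ↔ Integrable f ν := by
  have h := integrable_map_equiv shiftEquiv f (μ := ν)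
  rw [coe_shiftEquiv, hν] at h
  exact h.symm

/-- A Gibbs mixture is a probability measure. [folklore] -/
theorem IsGibbsMixture.isProbabilityMeasure {P : OscillatorChain} {ν : Measure ChainConfig}
    (h : IsGibbsMixture P ν) : IsProbabilityMeasure ν := by
  obtain ⟨π, κ, hπ, hκ, hae, rfl⟩ := h
  constructor
  rw [Measure.bind_apply MeasurableSet.univ hκ.aemeasurable]
  have : ∀ᵐ T ∂π, κ T Set.univ = 1 := hae.mono fun T hT => by
    haveI := hT.2.isProbabilityMeasure; exact measure_univ
  rw [lintegral_congr_ae this, lintegral_const, measure_univ, one_mul]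

/-! ### Local test functions: re-boxing and closure properties -/

section TestFunctions

variable {E F : Type*} [NormedAddCommGroup E] [NormedSpace ℝ E] [NormedAddCommGroup F]
  [NormedSpace ℝ F]

/-- Precomposition with a continuous linear map preserves "`C¹`, bounded, bounded derivative".
[folklore] -/
theorem c1Bounded_comp_clm {g : F → ℝ} (L : E →L[ℝ] F) (hg : ContDiff ℝ 1 g)
    (hb : ∃ M : ℝ, ∀ y, |g y| ≤ M) (hd : ∃ M' : ℝ, ∀ y, ‖fderiv ℝ g y‖ ≤ M') :
    ContDiff ℝ 1 (g ∘ L) ∧ (∃ M : ℝ, ∀ y, |(g ∘ L) y| ≤ M) ∧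
      (∃ M' : ℝ, ∀ y, ‖fderiv ℝ (g ∘ L) y‖ ≤ M') := by
  refine ⟨hg.comp L.contDiff, ?_, ?_⟩
  · obtain ⟨M, hM⟩ := hb
    exact ⟨M, fun y => hM (L y)⟩
  · obtain ⟨M', hM'⟩ := hd
    have hM'0 : 0 ≤ M' := (norm_nonneg _).trans (hM' 0)
    refine ⟨M' * ‖L‖, fun y => ?_⟩
    rw [fderiv_comp y ((hg.differentiable one_ne_zero) _) L.differentiableAt, L.fderiv]
    exact (ContinuousLinearMap.opNorm_comp_le _ _).trans
      (mul_le_mul_of_nonneg_right (hM' _) (norm_nonneg _))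

end TestFunctions

/-- **Re-boxing.** A `C¹`-bounded profile on ANY box `{a, …, a+n}` contained in the centred box
`{-R, …, R}` is a `C¹`-bounded profile on the centred box: `g ∘ boxRestrictAt a n = g' ∘ boxRestrict R`
with `g' = g ∘ π`, `π` the coordinate projection. [folklore] -/
theorem exists_comp_boxRestrict_of_boxRestrictAt {a : ℤ} {n R : ℕ} (ha : -(R : ℤ) ≤ a)
    (hb : a + n ≤ R) {g : (Fin (n + 1) → ℝ × ℝ) → ℝ} (hg : ContDiff ℝ 1 g)
    (hbd : ∃ M : ℝ, ∀ y, |g y| ≤ M) (hd : ∃ M' : ℝ, ∀ y, ‖fderiv ℝ g y‖ ≤ M') :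
    ∃ g' : (Fin (2 * R + 1) → ℝ × ℝ) → ℝ, ContDiff ℝ 1 g' ∧ (∃ M : ℝ, ∀ y, |g' y| ≤ M) ∧
      (∃ M' : ℝ, ∀ y, ‖fderiv ℝ g' y‖ ≤ M') ∧ g ∘ boxRestrictAt a n = g' ∘ boxRestrict R := by
  -- the index of site `a + i` in the centred box is `a + i + R ∈ {0, …, 2R}`
  let idx : Fin (n + 1) → Fin (2 * R + 1) := fun i =>
    ⟨(a + i + R).toNat, by have := i.isLt; omega⟩
  have hidx : ∀ i : Fin (n + 1), ((idx i : ℕ) : ℤ) - R = a + i := by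
    intro i
    have := i.isLt
    simp only [idx]
    omega
  let π : (Fin (2 * R + 1) → ℝ × ℝ) →L[ℝ] (Fin (n + 1) → ℝ × ℝ) :=
    ContinuousLinearMap.pi fun i => ContinuousLinearMap.proj (idx i)
  refine ⟨g ∘ π, (c1Bounded_comp_clm π hg hbd hd).1, (c1Bounded_comp_clm π hg hbd hd).2.1,
    (c1Bounded_comp_clm π hg hbd hd).2.2, ?_⟩
  funext σ
  simp only [Function.comp_apply]
  congr 1
  funext i
  simp only [boxRestrictAt_apply, π, ContinuousLinearMap.pi_apply, ContinuousLinearMap.proj_apply,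
    boxRestrict_apply, hidx]

/-- A `C¹`-bounded profile on any finite box `{a, …, a+n}` defines a local test function.
[cite: Bernardin2014, §1.1 (definition of `C₀ᵏ(X)`)] -/
theorem isLocalTestFunction_comp_boxRestrictAt (a : ℤ) (n : ℕ) {g : (Fin (n + 1) → ℝ × ℝ) → ℝ}
    (hg : ContDiff ℝ 1 g) (hbd : ∃ M : ℝ, ∀ y, |g y| ≤ M)
    (hd : ∃ M' : ℝ, ∀ y, ‖fderiv ℝ g y‖ ≤ M') : IsLocalTestFunction (g ∘ boxRestrictAt a n) := by
  obtain ⟨g', h1, h2, h3, h4⟩ := exists_comp_boxRestrict_of_boxRestrictAt (R := a.natAbs + n)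
    (a := a) (n := n) (by omega) (by omega) hg hbd hd
  exact ⟨a.natAbs + n, g', h1, h2, h3, h4⟩

/-- A local test function can be represented on every larger centred box. [folklore] -/
theorem IsLocalTestFunction.exists_rep {f : ChainConfig → ℝ} (hf : IsLocalTestFunction f) :
    ∃ R₀ : ℕ, ∀ R : ℕ, R₀ ≤ R → ∃ g : (Fin (2 * R + 1) → ℝ × ℝ) → ℝ, ContDiff ℝ 1 g ∧
      (∃ M : ℝ, ∀ y, |g y| ≤ M) ∧ (∃ M' : ℝ, ∀ y, ‖fderiv ℝ g y‖ ≤ M') ∧ f = g ∘ boxRestrict R := by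
  obtain ⟨R₀, g, hg, hbd, hd, rfl⟩ := hf
  refine ⟨R₀, fun R hR => ?_⟩
  rw [boxRestrict_eq_boxRestrictAt]
  exact exists_comp_boxRestrict_of_boxRestrictAt (by omega) (by push_cast; omega) hg hbd hd

/-- `C₀¹` is closed under scalar multiplication. [folklore] -/
theorem IsLocalTestFunction.const_mul {f : ChainConfig → ℝ} (hf : IsLocalTestFunction f) (c : ℝ) :
    IsLocalTestFunction fun σ => c * f σ := by
  obtain ⟨R, g, hg, ⟨M, hM⟩, ⟨M', hM'⟩, rfl⟩ := hf
  refine ⟨R, fun y => c * g y, contDiff_const.mul hg, ⟨|c| * M, fun y => ?_⟩,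
    ⟨|c| * M', fun y => ?_⟩, rfl⟩
  · rw [abs_mul]; exact mul_le_mul_of_nonneg_left (hM y) (abs_nonneg c)
  · have hdg : DifferentiableAt ℝ g y := (hg.differentiable one_ne_zero) y
    rw [fderiv_const_mul hdg c, norm_smul, Real.norm_eq_abs]
    exact mul_le_mul_of_nonneg_left (hM' y) (abs_nonneg c)

/-- `C₀¹` is closed under negation. [folklore] -/
theorem IsLocalTestFunction.neg {f : ChainConfig → ℝ} (hf : IsLocalTestFunction f) :
    IsLocalTestFunction fun σ => -f σ := by
  simpa using hf.const_mul (-1)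

/-- `C₀¹` is closed under addition (re-box both summands on a common centred box). [folklore] -/
theorem IsLocalTestFunction.add {f₁ f₂ : ChainConfig → ℝ} (h₁ : IsLocalTestFunction f₁)
    (h₂ : IsLocalTestFunction f₂) : IsLocalTestFunction fun σ => f₁ σ + f₂ σ := by
  obtain ⟨R₁, hR₁⟩ := h₁.exists_rep
  obtain ⟨R₂, hR₂⟩ := h₂.exists_rep
  obtain ⟨g₁, hg₁, ⟨M₁, hM₁⟩, ⟨M₁', hM₁'⟩, rfl⟩ := hR₁ (max R₁ R₂) (le_max_left _ _)
  obtain ⟨g₂, hg₂, ⟨M₂, hM₂⟩, ⟨M₂', hM₂'⟩, rfl⟩ := hR₂ (max R₁ R₂) (le_max_right _ _)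
  refine ⟨max R₁ R₂, fun y => g₁ y + g₂ y, hg₁.add hg₂, ⟨M₁ + M₂, fun y => ?_⟩,
    ⟨M₁' + M₂', fun y => ?_⟩, rfl⟩
  · exact (abs_add_le _ _).trans (add_le_add (hM₁ y) (hM₂ y))
  · have hd₁ : DifferentiableAt ℝ g₁ y := (hg₁.differentiable one_ne_zero) y
    have hd₂ : DifferentiableAt ℝ g₂ y := (hg₂.differentiable one_ne_zero) y
    rw [fderiv_fun_add hd₁ hd₂]
    exact (norm_add_le _ _).trans (add_le_add (hM₁' y) (hM₂' y))

/-- `C₀¹` is stable under the shift: `f ∘ τ` is represented on the box `{1-R, …, R+1}`.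
[folklore] -/
theorem IsLocalTestFunction.comp_shift {f : ChainConfig → ℝ} (hf : IsLocalTestFunction f) :
    IsLocalTestFunction (f ∘ shift) := by
  obtain ⟨R, g, hg, hbd, hd, rfl⟩ := hf
  have : (g ∘ boxRestrict R) ∘ shift = g ∘ boxRestrictAt (1 - (R : ℤ)) (2 * R) := by
    funext σ
    simp only [Function.comp_apply]
    congr 1
    funext i
    simp only [boxRestrict_apply, shift, boxRestrictAt_apply]
    congr 1
    ring
  rw [this]
  exact isLocalTestFunction_comp_boxRestrictAt _ _ hg hbd hd

/-- `C₀¹` is stable under momentum reversal: `f ∘ R = (g ∘ R_box) ∘ boxRestrict R` with `R_box`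
the (linear, isometric) momentum reversal of the box. [folklore] -/
theorem IsLocalTestFunction.comp_momentumReversalZ {f : ChainConfig → ℝ} (hf : IsLocalTestFunction f) :
    IsLocalTestFunction (f ∘ momentumReversalZ) := by
  obtain ⟨R, g, hg, hbd, hd, rfl⟩ := hf
  let L : (Fin (2 * R + 1) → ℝ × ℝ) →L[ℝ] (Fin (2 * R + 1) → ℝ × ℝ) :=
    ContinuousLinearMap.pi fun i =>
      ((ContinuousLinearMap.fst ℝ ℝ ℝ).comp (ContinuousLinearMap.proj i)).prod
        (-((ContinuousLinearMap.snd ℝ ℝ ℝ).comp (ContinuousLinearMap.proj i)))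
  have hL : ∀ (y : Fin (2 * R + 1) → ℝ × ℝ) (i : Fin (2 * R + 1)), L y i = ((y i).1, -(y i).2) := by
    intro y i
    simp [L]
  have : (g ∘ boxRestrict R) ∘ momentumReversalZ = (g ∘ L) ∘ boxRestrict R := by
    funext σ
    have hbox : boxRestrict R (momentumReversalZ σ) = L (boxRestrict R σ) :=
      funext fun i => by rw [hL]; rfl
    simp only [Function.comp_apply, hbox]
  rw [this]
  exact ⟨R, g ∘ L, (c1Bounded_comp_clm L hg hbd hd).1, (c1Bounded_comp_clm L hg hbd hd).2.1,
    (c1Bounded_comp_clm L hg hbd hd).2.2, rfl⟩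

/-- Local test functions are measurable. [folklore] -/
theorem IsLocalTestFunction.measurable {f : ChainConfig → ℝ} (hf : IsLocalTestFunction f) :
    Measurable f := by
  obtain ⟨R, g, hg, -, -, rfl⟩ := hf
  exact hg.continuous.measurable.comp (boxRestrict_measurable R)

/-- Local test functions are bounded. [folklore] -/
theorem IsLocalTestFunction.exists_bound {f : ChainConfig → ℝ} (hf : IsLocalTestFunction f) :
    ∃ M : ℝ, ∀ σ, |f σ| ≤ M := by
  obtain ⟨R, g, -, ⟨M, hM⟩, -, rfl⟩ := hf
  exact ⟨M, fun σ => hM _⟩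

/-- Local test functions are integrable against every finite measure. [folklore] -/
theorem IsLocalTestFunction.integrable {f : ChainConfig → ℝ} (hf : IsLocalTestFunction f)
    (ν : Measure ChainConfig) [IsFiniteMeasure ν] : Integrable f ν := by
  obtain ⟨M, hM⟩ := hf.exists_bound
  refine Integrable.of_bound (hf.measurable.aestronglyMeasurable) M ?_
  exact Filter.Eventually.of_forall fun σ => by simpa [Real.norm_eq_abs] using hM σ

/-! ### The Liouville operator of a local function is a finite box sum -/

/-- Updating a site of the box moves the box restriction by the corresponding update. [folklore] -/
theorem boxRestrictAt_update_of_eq (a : ℤ) (n : ℕ) (σ : ChainConfig) (i : Fin (n + 1)) (v : ℝ × ℝ) :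
    boxRestrictAt a n (Function.update σ (a + i) v) = Function.update (boxRestrictAt a n σ) i v := by
  funext j
  by_cases hj : j = i
  · subst hj; simp
  · have hne : (a + (j : ℤ)) ≠ a + i := by
      intro h
      apply hj
      apply Fin.ext
      have : ((j : ℕ) : ℤ) = (i : ℕ) := by linarith
      exact_mod_cast this
    simp [Function.update_of_ne hne, Function.update_of_ne hj]

/-- Updating a site outside the box does not change the box restriction. [folklore] -/
theorem boxRestrictAt_update_of_forall_ne (a : ℤ) (n : ℕ) (σ : ChainConfig) {x : ℤ}
    (hx : ∀ i : Fin (n + 1), x ≠ a + i) (v : ℝ × ℝ) :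
    boxRestrictAt a n (Function.update σ x v) = boxRestrictAt a n σ := by
  funext j
  simp [Function.update_of_ne (Ne.symm (hx j))]

/-- `(ContinuousLinearMap.pi (Pi.single i id)) v = Pi.single i v`. [folklore] -/
theorem pi_single_id_apply {n : ℕ} (i : Fin (n + 1)) (v : ℝ × ℝ) :
    (ContinuousLinearMap.pi (Pi.single i (ContinuousLinearMap.id ℝ (ℝ × ℝ))) :
      (ℝ × ℝ) →L[ℝ] (Fin (n + 1) → ℝ × ℝ)) v = Pi.single i v := by
  funext j
  rw [ContinuousLinearMap.pi_apply]
  by_cases hj : j = i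
  · subst hj; simp
  · simp [Pi.single_eq_of_ne hj]

/-- `∂_{q_{a+i}} (g ∘ box_{a,n}) = Dg(box σ) · e_i^q` at a point of differentiability. [folklore] -/
theorem partialQZ_comp_boxRestrictAt_of_eq (a : ℤ) (n : ℕ) {g : (Fin (n + 1) → ℝ × ℝ) → ℝ}
    (σ : ChainConfig) (i : Fin (n + 1)) (hg : DifferentiableAt ℝ g (boxRestrictAt a n σ)) :
    partialQZ (a + i) (g ∘ boxRestrictAt a n) σ =
      fderiv ℝ g (boxRestrictAt a n σ) (Pi.single i (1, 0)) := by
  unfold partialQZ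
  have hcurve : HasDerivAt (fun t : ℝ => (t, (σ (a + i)).2)) ((1 : ℝ), (0 : ℝ)) (σ (a + i)).1 :=
    (hasDerivAt_id _).prodMk (hasDerivAt_const _ _)
  have hupd := hasFDerivAt_update (𝕜 := ℝ) (boxRestrictAt a n σ) (i := i) ((σ (a + i)).1, (σ (a + i)).2)
  have hpt : Function.update (boxRestrictAt a n σ) i ((σ (a + i)).1, (σ (a + i)).2) = boxRestrictAt a n σ := by
    rw [Prod.mk.eta]
    exact Function.update_eq_self i (boxRestrictAt a n σ)
  have hg' : HasFDerivAt g (fderiv ℝ g (boxRestrictAt a n σ))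
      (Function.update (boxRestrictAt a n σ) i ((σ (a + i)).1, (σ (a + i)).2)) := by
    rw [hpt]; exact hg.hasFDerivAt
  have hcomp : HasDerivAt ((g ∘ Function.update (boxRestrictAt a n σ) i) ∘ fun t : ℝ => (t, (σ (a + i)).2))
      (((fderiv ℝ g (boxRestrictAt a n σ)).comp
        (ContinuousLinearMap.pi (Pi.single i (ContinuousLinearMap.id ℝ (ℝ × ℝ))))) ((1 : ℝ), (0 : ℝ)))
      (σ (a + i)).1 :=
    HasFDerivAt.comp_hasDerivAt (σ (a + i)).1 (hg'.comp _ hupd) hcurve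
  have heq : (fun t => (g ∘ boxRestrictAt a n) (Function.update σ (a + i) (t, (σ (a + i)).2))) =
      (g ∘ Function.update (boxRestrictAt a n σ) i) ∘ fun t : ℝ => (t, (σ (a + i)).2) := by
    funext t
    simp only [Function.comp_apply, boxRestrictAt_update_of_eq]
  rw [heq, hcomp.deriv]
  simp only [ContinuousLinearMap.coe_comp, Function.comp_apply, pi_single_id_apply]

/-- `∂_{p_{a+i}} (g ∘ box_{a,n}) = Dg(box σ) · e_i^p` at a point of differentiability. [folklore] -/
theorem partialPZ_comp_boxRestrictAt_of_eq (a : ℤ) (n : ℕ) {g : (Fin (n + 1) → ℝ × ℝ) → ℝ}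
    (σ : ChainConfig) (i : Fin (n + 1)) (hg : DifferentiableAt ℝ g (boxRestrictAt a n σ)) :
    partialPZ (a + i) (g ∘ boxRestrictAt a n) σ =
      fderiv ℝ g (boxRestrictAt a n σ) (Pi.single i (0, 1)) := by
  unfold partialPZ
  have hcurve : HasDerivAt (fun t : ℝ => ((σ (a + i)).1, t)) ((0 : ℝ), (1 : ℝ)) (σ (a + i)).2 :=
    (hasDerivAt_const _ _).prodMk (hasDerivAt_id _)
  have hupd := hasFDerivAt_update (𝕜 := ℝ) (boxRestrictAt a n σ) (i := i) ((σ (a + i)).1, (σ (a + i)).2)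
  have hpt : Function.update (boxRestrictAt a n σ) i ((σ (a + i)).1, (σ (a + i)).2) = boxRestrictAt a n σ := by
    rw [Prod.mk.eta]
    exact Function.update_eq_self i (boxRestrictAt a n σ)
  have hg' : HasFDerivAt g (fderiv ℝ g (boxRestrictAt a n σ))
      (Function.update (boxRestrictAt a n σ) i ((σ (a + i)).1, (σ (a + i)).2)) := by
    rw [hpt]; exact hg.hasFDerivAt
  have hcomp : HasDerivAt ((g ∘ Function.update (boxRestrictAt a n σ) i) ∘ fun t : ℝ => ((σ (a + i)).1, t))
      (((fderiv ℝ g (boxRestrictAt a n σ)).comp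
        (ContinuousLinearMap.pi (Pi.single i (ContinuousLinearMap.id ℝ (ℝ × ℝ))))) ((0 : ℝ), (1 : ℝ)))
      (σ (a + i)).2 :=
    HasFDerivAt.comp_hasDerivAt (σ (a + i)).2 (hg'.comp _ hupd) hcurve
  have heq : (fun t => (g ∘ boxRestrictAt a n) (Function.update σ (a + i) ((σ (a + i)).1, t))) =
      (g ∘ Function.update (boxRestrictAt a n σ) i) ∘ fun t : ℝ => ((σ (a + i)).1, t) := by
    funext t
    simp only [Function.comp_apply, boxRestrictAt_update_of_eq]
  rw [heq, hcomp.deriv]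
  simp only [ContinuousLinearMap.coe_comp, Function.comp_apply, pi_single_id_apply]

/-- Off the box both partial derivatives of `g ∘ box_{a,n}` vanish. [folklore] -/
theorem partialQZ_comp_boxRestrictAt_of_forall_ne (a : ℤ) (n : ℕ) (g : (Fin (n + 1) → ℝ × ℝ) → ℝ)
    (σ : ChainConfig) {x : ℤ} (hx : ∀ i : Fin (n + 1), x ≠ a + i) :
    partialQZ x (g ∘ boxRestrictAt a n) σ = 0 ∧ partialPZ x (g ∘ boxRestrictAt a n) σ = 0 := by
  simp only [partialQZ, partialPZ, Function.comp_apply, boxRestrictAt_update_of_forall_ne a n σ hx,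
    deriv_const]
  exact ⟨trivial, trivial⟩

/-- **The Liouville operator of a local function is a finite box sum**: for `f = g ∘ box_{a,n}`
with `g` differentiable at the point,
`𝒜f(σ) = ∑_{i=0}^{n} (p_{a+i} · Dg(e_i^q) + F_{a+i} · Dg(e_i^p))`. [cite: Bernardin2014, §1.1] -/
theorem liouvilleZ_comp_boxRestrictAt (P : OscillatorChain) (a : ℤ) (n : ℕ)
    {g : (Fin (n + 1) → ℝ × ℝ) → ℝ} (σ : ChainConfig)
    (hg : DifferentiableAt ℝ g (boxRestrictAt a n σ)) :
    liouvilleZ P (g ∘ boxRestrictAt a n) σ =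
      ∑ i : Fin (n + 1), ((σ (a + i)).2 * fderiv ℝ g (boxRestrictAt a n σ) (Pi.single i (1, 0)) +
        P.force σ (a + i) * fderiv ℝ g (boxRestrictAt a n σ) (Pi.single i (0, 1))) := by
  classical
  unfold liouvilleZ
  have hinj : Function.Injective fun i : Fin (n + 1) => a + (i : ℤ) := by
    intro i j h
    apply Fin.ext
    have : ((i : ℕ) : ℤ) = (j : ℕ) := by simpa using h
    exact_mod_cast this
  rw [tsum_eq_sum (s := Finset.univ.image fun i : Fin (n + 1) => a + (i : ℤ))]
  · rw [Finset.sum_image fun i _ j _ h => hinj h]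
    refine Finset.sum_congr rfl fun i _ => ?_
    rw [partialQZ_comp_boxRestrictAt_of_eq a n σ i hg, partialPZ_comp_boxRestrictAt_of_eq a n σ i hg]
  · intro x hx
    have hx' : ∀ i : Fin (n + 1), x ≠ a + i := by
      intro i h
      exact hx (Finset.mem_image.mpr ⟨i, Finset.mem_univ _, h.symm⟩)
    obtain ⟨h1, h2⟩ := partialQZ_comp_boxRestrictAt_of_forall_ne a n g σ hx'
    rw [h1, h2, mul_zero, mul_zero, add_zero]

/-- The centred-box version of `liouvilleZ_comp_boxRestrictAt` (the representation used in
`IsLocalTestFunction`): `𝒜(g ∘ box_R)(σ) = ∑_{i=0}^{2R} (p_{i-R} Dg(e_i^q) + F_{i-R} Dg(e_i^p))`.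
[cite: Bernardin2014, §1.1] -/
theorem liouvilleZ_comp_boxRestrict (P : OscillatorChain) (R : ℕ)
    {g : (Fin (2 * R + 1) → ℝ × ℝ) → ℝ} (σ : ChainConfig)
    (hg : DifferentiableAt ℝ g (boxRestrict R σ)) :
    liouvilleZ P (g ∘ boxRestrict R) σ =
      ∑ i : Fin (2 * R + 1), ((σ ((i : ℤ) - R)).2 * fderiv ℝ g (boxRestrict R σ) (Pi.single i (1, 0)) +
        P.force σ ((i : ℤ) - R) * fderiv ℝ g (boxRestrict R σ) (Pi.single i (0, 1))) := by
  rw [boxRestrict_eq_boxRestrictAt] at hg ⊢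
  rw [liouvilleZ_comp_boxRestrictAt P _ _ σ hg]
  refine Finset.sum_congr rfl fun i _ => ?_
  have : (-(R : ℤ)) + (i : ℤ) = (i : ℤ) - R := by ring
  rw [this]

/-- **Hamilton's equation `q̇_x = p_x`** through the Liouville operator: `𝒜 q_x = p_x`. [folklore] -/
theorem liouvilleZ_position (P : OscillatorChain) (x : ℤ) (σ : ChainConfig) :
    liouvilleZ P (fun σ => (σ x).1) σ = (σ x).2 := by
  let L : (Fin (0 + 1) → ℝ × ℝ) →L[ℝ] ℝ :=
    (ContinuousLinearMap.fst ℝ ℝ ℝ).comp (ContinuousLinearMap.proj 0)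
  have hf : (fun σ : ChainConfig => (σ x).1) = L ∘ boxRestrictAt x 0 := by
    funext σ; simp [L]
  rw [hf, liouvilleZ_comp_boxRestrictAt P x 0 σ L.differentiableAt]
  simp [L, ContinuousLinearMap.fderiv]

/-- **Hamilton's equation `ṗ_x = F_x`** through the Liouville operator: `𝒜 p_x = F_x`. [folklore] -/
theorem liouvilleZ_momentum (P : OscillatorChain) (x : ℤ) (σ : ChainConfig) :
    liouvilleZ P (fun σ => (σ x).2) σ = P.force σ x := by
  let L : (Fin (0 + 1) → ℝ × ℝ) →L[ℝ] ℝ :=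
    (ContinuousLinearMap.snd ℝ ℝ ℝ).comp (ContinuousLinearMap.proj 0)
  have hf : (fun σ : ChainConfig => (σ x).2) = L ∘ boxRestrictAt x 0 := by
    funext σ; simp [L]
  rw [hf, liouvilleZ_comp_boxRestrictAt P x 0 σ L.differentiableAt]
  simp [L, ContinuousLinearMap.fderiv]

/-- The Liouville operator kills constants. [folklore] -/
@[simp] theorem liouvilleZ_const (P : OscillatorChain) (c : ℝ) : liouvilleZ P (fun _ => c) = 0 := by
  funext σ
  simp [liouvilleZ, partialQZ, partialPZ]

/-! ### Measurability and growth of `𝒜f` for local test functions -/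

/-- The force field is measurable in the configuration — for EVERY chain (the derivative of an
arbitrary real function is measurable, Mathlib `measurable_deriv`). [folklore] -/
@[fun_prop]
theorem measurable_force (P : OscillatorChain) (x : ℤ) : Measurable fun σ : ChainConfig => P.force σ x := by
  simp only [OscillatorChain.force, OscillatorChain.interactionForce]
  have hq : ∀ y : ℤ, Measurable fun σ : ChainConfig => (σ y).1 := fun y => (measurable_pi_apply y).fst
  exact (((measurable_deriv P.U).comp (hq x)).neg).add
    (((measurable_deriv P.V).comp ((hq (x + 1)).sub (hq x))).sub
      ((measurable_deriv P.V).comp ((hq x).sub (hq (x - 1)))))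

/-- The bond current is measurable in the configuration (every chain). [folklore] -/
@[fun_prop]
theorem measurable_bondCurrentZ (P : OscillatorChain) (x : ℤ) :
    Measurable fun σ : ChainConfig => P.bondCurrentZ σ x := by
  simp only [OscillatorChain.bondCurrentZ]
  have hq : ∀ y : ℤ, Measurable fun σ : ChainConfig => (σ y).1 := fun y => (measurable_pi_apply y).fst
  have hp : ∀ y : ℤ, Measurable fun σ : ChainConfig => (σ y).2 := fun y => (measurable_pi_apply y).snd
  exact ((((hp x).add (hp (x + 1))).div_const 2).mul
    ((measurable_deriv P.V).comp ((hq (x + 1)).sub (hq x)))).neg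

/-- `σ ↦ Dg(box_R σ) · v` is measurable for a `C¹` profile `g`. [folklore] -/
theorem measurable_fderiv_comp_boxRestrict_apply {R : ℕ} {g : (Fin (2 * R + 1) → ℝ × ℝ) → ℝ}
    (hg : ContDiff ℝ 1 g) (v : Fin (2 * R + 1) → ℝ × ℝ) :
    Measurable fun σ : ChainConfig => fderiv ℝ g (boxRestrict R σ) v := by
  have hc : Continuous fun y => fderiv ℝ g y v :=
    (ContinuousLinearMap.apply ℝ ℝ v).continuous.comp (hg.continuous_fderiv one_ne_zero)
  exact hc.measurable.comp (boxRestrict_measurable R)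

/-- **`𝒜f` is measurable for `f ∈ C₀¹`** (every chain): by the box formula it is a finite sum of
products of measurable functions. [folklore] -/
theorem IsLocalTestFunction.measurable_liouvilleZ {f : ChainConfig → ℝ} (hf : IsLocalTestFunction f)
    (P : OscillatorChain) : Measurable (liouvilleZ P f) := by
  obtain ⟨R, g, hg, -, -, rfl⟩ := hf
  have heq : liouvilleZ P (g ∘ boxRestrict R) = fun σ => ∑ i : Fin (2 * R + 1),
      ((σ ((i : ℤ) - R)).2 * fderiv ℝ g (boxRestrict R σ) (Pi.single i (1, 0)) +
        P.force σ ((i : ℤ) - R) * fderiv ℝ g (boxRestrict R σ) (Pi.single i (0, 1))) :=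
    funext fun σ => liouvilleZ_comp_boxRestrict P R σ ((hg.differentiable one_ne_zero) _)
  rw [heq]
  refine Finset.measurable_sum _ fun i _ => ?_
  exact ((measurable_pi_apply _).snd.mul (measurable_fderiv_comp_boxRestrict_apply hg _)).add
    ((measurable_force P _).mul (measurable_fderiv_comp_boxRestrict_apply hg _))

/-- **Growth of `𝒜f` for `f ∈ C₀¹`**: `|𝒜f(σ)| ≤ M' ∑_{|x| ≤ R} (|p_x| + |F_x(σ)|)` with `M'` the
bound on the derivative of the profile — `𝒜f` grows like the momenta and forces in the box (this
is why `IsTimeInvariant` carries an integrability conjunct). [folklore] -/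
theorem IsLocalTestFunction.exists_abs_liouvilleZ_le {f : ChainConfig → ℝ} (hf : IsLocalTestFunction f)
    (P : OscillatorChain) : ∃ (R : ℕ) (C : ℝ), 0 ≤ C ∧ ∀ σ : ChainConfig,
      |liouvilleZ P f σ| ≤ C * ∑ i : Fin (2 * R + 1), (|(σ ((i : ℤ) - R)).2| + |P.force σ ((i : ℤ) - R)|) := by
  obtain ⟨R, g, hg, -, ⟨M', hM'⟩, rfl⟩ := hf
  have hM'0 : 0 ≤ M' := (norm_nonneg _).trans (hM' 0)
  refine ⟨R, M', hM'0, fun σ => ?_⟩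
  rw [liouvilleZ_comp_boxRestrict P R σ ((hg.differentiable one_ne_zero) _), Finset.mul_sum]
  refine (Finset.abs_sum_le_sum_abs _ _).trans (Finset.sum_le_sum fun i _ => ?_)
  have hD : ∀ v : Fin (2 * R + 1) → ℝ × ℝ, ‖v‖ ≤ 1 → |fderiv ℝ g (boxRestrict R σ) v| ≤ M' := by
    intro v hv
    rw [← Real.norm_eq_abs]
    calc ‖fderiv ℝ g (boxRestrict R σ) v‖ ≤ ‖fderiv ℝ g (boxRestrict R σ)‖ * ‖v‖ :=
          ContinuousLinearMap.le_opNorm _ _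
      _ ≤ M' * 1 := mul_le_mul (hM' _) hv (norm_nonneg _) hM'0
      _ = M' := mul_one _
  have h1 : ‖(Pi.single i ((1 : ℝ), (0 : ℝ)) : Fin (2 * R + 1) → ℝ × ℝ)‖ ≤ 1 := by
    rw [Pi.norm_single]; simp [Prod.norm_def]
  have h2 : ‖(Pi.single i ((0 : ℝ), (1 : ℝ)) : Fin (2 * R + 1) → ℝ × ℝ)‖ ≤ 1 := by
    rw [Pi.norm_single]; simp [Prod.norm_def]
  calc |(σ ((i : ℤ) - R)).2 * fderiv ℝ g (boxRestrict R σ) (Pi.single i (1, 0)) +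
        P.force σ ((i : ℤ) - R) * fderiv ℝ g (boxRestrict R σ) (Pi.single i (0, 1))|
      ≤ |(σ ((i : ℤ) - R)).2| * |fderiv ℝ g (boxRestrict R σ) (Pi.single i (1, 0))| +
        |P.force σ ((i : ℤ) - R)| * |fderiv ℝ g (boxRestrict R σ) (Pi.single i (0, 1))| := by
          rw [← abs_mul, ← abs_mul]; exact abs_add_le _ _
    _ ≤ |(σ ((i : ℤ) - R)).2| * M' + |P.force σ ((i : ℤ) - R)| * M' :=
          add_le_add (mul_le_mul_of_nonneg_left (hD _ h1) (abs_nonneg _))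
            (mul_le_mul_of_nonneg_left (hD _ h2) (abs_nonneg _))
    _ = M' * (|(σ ((i : ℤ) - R)).2| + |P.force σ ((i : ℤ) - R)|) := by ring

/-- At the rest configuration `σ ≡ (0, 0)` of a chain with `U'(0) = 0`, `𝒜f = 0` for every local
test function (all momenta and forces vanish). [folklore] -/
theorem IsLocalTestFunction.liouvilleZ_rest_eq_zero {f : ChainConfig → ℝ} (hf : IsLocalTestFunction f)
    (P : OscillatorChain) (hU : deriv P.U 0 = 0) :
    liouvilleZ P f (fun _ => ((0 : ℝ), (0 : ℝ))) = 0 := by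
  obtain ⟨R, C, -, hC⟩ := hf.exists_abs_liouvilleZ_le P
  have h := hC (fun _ => ((0 : ℝ), (0 : ℝ)))
  have hF : ∀ x : ℤ, P.force (fun _ => ((0 : ℝ), (0 : ℝ))) x = 0 := fun x => by
    simp [OscillatorChain.force, OscillatorChain.interactionForce, hU]
  simp only [hF, abs_zero, add_zero, Finset.sum_const_zero, mul_zero] at h
  exact abs_nonpos_iff.mp h

/-- **Non-vacuity of `IsTimeInvariant`**: the Dirac mass at the rest configuration of a chain with
`U'(0) = 0` is a time-invariant (and shift-invariant) probability measure. [folklore] -/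
theorem isTimeInvariant_dirac_rest (P : OscillatorChain) (hU : deriv P.U 0 = 0) :
    IsTimeInvariant P (Measure.dirac fun _ => ((0 : ℝ), (0 : ℝ))) := by
  intro f hf
  have hmeas : Measurable (liouvilleZ P f) := hf.measurable_liouvilleZ P
  refine ⟨(integrable_const (liouvilleZ P f fun _ => ((0 : ℝ), (0 : ℝ)))).congr
    (ae_eq_dirac' hmeas).symm, ?_⟩
  rw [integral_dirac' _ _ hmeas.stronglyMeasurable, hf.liouvilleZ_rest_eq_zero P hU]

/-- The Dirac mass at the rest configuration is shift invariant. [folklore] -/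
theorem isShiftInvariant_dirac_rest : IsShiftInvariant (Measure.dirac fun _ : ℤ => ((0 : ℝ), (0 : ℝ))) := by
  unfold IsShiftInvariant
  rw [Measure.map_dirac' shift_measurable]
  rfl

/-! ### Linearity of `𝒜` on local test functions -/

/-- **`𝒜` is additive on `C₀¹`**: `𝒜(f + g) = 𝒜f + 𝒜g` for local test functions (re-box both on
a common centred box and use the box formula; for general `f`, `g` the `tsum` need not split).
[folklore] -/
theorem IsLocalTestFunction.liouvilleZ_add {f g : ChainConfig → ℝ} (hf : IsLocalTestFunction f)
    (hg : IsLocalTestFunction g) (P : OscillatorChain) :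
    liouvilleZ P (fun σ => f σ + g σ) = fun σ => liouvilleZ P f σ + liouvilleZ P g σ := by
  obtain ⟨R₁, hR₁⟩ := hf.exists_rep
  obtain ⟨R₂, hR₂⟩ := hg.exists_rep
  obtain ⟨g₁, hg₁, -, -, rfl⟩ := hR₁ (max R₁ R₂) (le_max_left _ _)
  obtain ⟨g₂, hg₂, -, -, rfl⟩ := hR₂ (max R₁ R₂) (le_max_right _ _)
  have hsum : (fun σ => (g₁ ∘ boxRestrict (max R₁ R₂)) σ + (g₂ ∘ boxRestrict (max R₁ R₂)) σ) =
      (fun y => g₁ y + g₂ y) ∘ boxRestrict (max R₁ R₂) := rfl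
  rw [hsum]
  funext σ
  have hd₁ : DifferentiableAt ℝ g₁ (boxRestrict (max R₁ R₂) σ) := (hg₁.differentiable one_ne_zero) _
  have hd₂ : DifferentiableAt ℝ g₂ (boxRestrict (max R₁ R₂) σ) := (hg₂.differentiable one_ne_zero) _
  have hd₁₂ : DifferentiableAt ℝ (fun y => g₁ y + g₂ y) (boxRestrict (max R₁ R₂) σ) := hd₁.add hd₂
  rw [liouvilleZ_comp_boxRestrict P _ σ hd₁₂, liouvilleZ_comp_boxRestrict P _ σ hd₁,
    liouvilleZ_comp_boxRestrict P _ σ hd₂, ← Finset.sum_add_distrib]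
  refine Finset.sum_congr rfl fun i _ => ?_
  rw [fderiv_fun_add hd₁ hd₂, add_apply, add_apply]
  ring

/-- **`𝒜` is homogeneous on `C₀¹`**: `𝒜(c f) = c 𝒜f`. [folklore] -/
theorem IsLocalTestFunction.liouvilleZ_const_mul {f : ChainConfig → ℝ} (hf : IsLocalTestFunction f)
    (c : ℝ) (P : OscillatorChain) :
    liouvilleZ P (fun σ => c * f σ) = fun σ => c * liouvilleZ P f σ := by
  obtain ⟨R, g, hg, -, -, rfl⟩ := hf
  have hmul : (fun σ => c * (g ∘ boxRestrict R) σ) = (fun y => c * g y) ∘ boxRestrict R := rfl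
  rw [hmul]
  funext σ
  have hd : DifferentiableAt ℝ g (boxRestrict R σ) := (hg.differentiable one_ne_zero) _
  have hdc : DifferentiableAt ℝ (fun y => c * g y) (boxRestrict R σ) := hd.const_mul c
  rw [liouvilleZ_comp_boxRestrict P _ σ hdc, liouvilleZ_comp_boxRestrict P _ σ hd, Finset.mul_sum]
  refine Finset.sum_congr rfl fun i _ => ?_
  rw [fderiv_const_mul hd c]
  simp only [FunLike.coe_smul, Pi.smul_apply, smul_eq_mul]
  ring

/-- `C₀¹` is closed under multiplication (re-box on a common centred box; the derivative of the
product profile is bounded by `M₁ M₂' + M₂ M₁'`). [folklore] -/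
theorem IsLocalTestFunction.mul {f₁ f₂ : ChainConfig → ℝ} (h₁ : IsLocalTestFunction f₁)
    (h₂ : IsLocalTestFunction f₂) : IsLocalTestFunction fun σ => f₁ σ * f₂ σ := by
  obtain ⟨R₁, hR₁⟩ := h₁.exists_rep
  obtain ⟨R₂, hR₂⟩ := h₂.exists_rep
  obtain ⟨g₁, hg₁, ⟨M₁, hM₁⟩, ⟨M₁', hM₁'⟩, rfl⟩ := hR₁ (max R₁ R₂) (le_max_left _ _)
  obtain ⟨g₂, hg₂, ⟨M₂, hM₂⟩, ⟨M₂', hM₂'⟩, rfl⟩ := hR₂ (max R₁ R₂) (le_max_right _ _)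
  refine ⟨max R₁ R₂, fun y => g₁ y * g₂ y, hg₁.mul hg₂, ⟨M₁ * M₂, fun y => ?_⟩,
    ⟨M₁ * M₂' + M₂ * M₁', fun y => ?_⟩, rfl⟩
  · rw [abs_mul]
    exact mul_le_mul (hM₁ y) (hM₂ y) (abs_nonneg _) ((abs_nonneg _).trans (hM₁ y))
  · have hd₁ : DifferentiableAt ℝ g₁ y := (hg₁.differentiable one_ne_zero) y
    have hd₂ : DifferentiableAt ℝ g₂ y := (hg₂.differentiable one_ne_zero) y
    rw [fderiv_fun_mul hd₁ hd₂]
    refine (norm_add_le _ _).trans (add_le_add ?_ ?_)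
    · rw [norm_smul, Real.norm_eq_abs]
      exact mul_le_mul (hM₁ y) (hM₂' y) (norm_nonneg _) ((abs_nonneg _).trans (hM₁ y))
    · rw [norm_smul, Real.norm_eq_abs]
      exact mul_le_mul (hM₂ y) (hM₁' y) (norm_nonneg _) ((abs_nonneg _).trans (hM₂ y))

/-- **Leibniz rule for `𝒜` on `C₀¹`**: `𝒜(fg) = f 𝒜g + g 𝒜f` (`𝒜` is a first-order differential
operator; box formula and the product rule for `fderiv`). [folklore] -/
theorem IsLocalTestFunction.liouvilleZ_mul {f g : ChainConfig → ℝ} (hf : IsLocalTestFunction f)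
    (hg : IsLocalTestFunction g) (P : OscillatorChain) :
    liouvilleZ P (fun σ => f σ * g σ) = fun σ => f σ * liouvilleZ P g σ + g σ * liouvilleZ P f σ := by
  obtain ⟨R₁, hR₁⟩ := hf.exists_rep
  obtain ⟨R₂, hR₂⟩ := hg.exists_rep
  obtain ⟨g₁, hg₁, -, -, rfl⟩ := hR₁ (max R₁ R₂) (le_max_left _ _)
  obtain ⟨g₂, hg₂, -, -, rfl⟩ := hR₂ (max R₁ R₂) (le_max_right _ _)
  have hprod : (fun σ => (g₁ ∘ boxRestrict (max R₁ R₂)) σ * (g₂ ∘ boxRestrict (max R₁ R₂)) σ) =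
      (fun y => g₁ y * g₂ y) ∘ boxRestrict (max R₁ R₂) := rfl
  rw [hprod]
  funext σ
  have hd₁ : DifferentiableAt ℝ g₁ (boxRestrict (max R₁ R₂) σ) := (hg₁.differentiable one_ne_zero) _
  have hd₂ : DifferentiableAt ℝ g₂ (boxRestrict (max R₁ R₂) σ) := (hg₂.differentiable one_ne_zero) _
  have hd₁₂ : DifferentiableAt ℝ (fun y => g₁ y * g₂ y) (boxRestrict (max R₁ R₂) σ) := hd₁.mul hd₂
  rw [liouvilleZ_comp_boxRestrict P _ σ hd₁₂, liouvilleZ_comp_boxRestrict P _ σ hd₁,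
    liouvilleZ_comp_boxRestrict P _ σ hd₂]
  simp only [Function.comp_apply, Finset.mul_sum, ← Finset.sum_add_distrib]
  refine Finset.sum_congr rfl fun i _ => ?_
  rw [fderiv_fun_mul hd₁ hd₂]
  simp only [add_apply, FunLike.coe_smul, Pi.smul_apply, smul_eq_mul]
  ring

/-- `𝒜(-f) = -𝒜f` on `C₀¹`. [folklore] -/
theorem IsLocalTestFunction.liouvilleZ_neg {f : ChainConfig → ℝ} (hf : IsLocalTestFunction f)
    (P : OscillatorChain) : liouvilleZ P (fun σ => -f σ) = fun σ => -liouvilleZ P f σ := by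
  have h := hf.liouvilleZ_const_mul (-1) P
  simp only [neg_one_mul] at h
  exact h

/-- **Time-invariant measures annihilate `𝒜` on the linear span of `C₀¹`** — the sum of two local
test functions being one, this is just additivity of the integral: stated for convenience.
[folklore] -/
theorem IsTimeInvariant.integral_liouvilleZ_add {P : OscillatorChain} {ν : Measure ChainConfig}
    (h : IsTimeInvariant P ν) {f g : ChainConfig → ℝ} (hf : IsLocalTestFunction f)
    (hg : IsLocalTestFunction g) :
    ∫ σ, liouvilleZ P (fun σ => f σ + g σ) σ ∂ν = 0 :=
  (h _ (hf.add hg)).2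

/-! ### Shift covariance -/

/-- The shift conjugates site updates: `τ(σ[x ↦ v]) = (τσ)[x-1 ↦ v]`. [folklore] -/
theorem shift_update_eq (σ : ChainConfig) (x : ℤ) (v : ℝ × ℝ) :
    shift (Function.update σ x v) = Function.update (shift σ) (x - 1) v := by
  funext y
  by_cases hy : y = x - 1
  · subst hy; simp [shift]
  · have : y + 1 ≠ x := fun h => hy (by omega)
    simp [shift, Function.update_of_ne this, Function.update_of_ne hy]

/-- `∂_{q_x}(f ∘ τ) = (∂_{q_{x-1}} f) ∘ τ`. [folklore] -/
theorem partialQZ_comp_shift_apply (x : ℤ) (f : ChainConfig → ℝ) (σ : ChainConfig) :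
    partialQZ x (f ∘ shift) σ = partialQZ (x - 1) f (shift σ) := by
  simp only [partialQZ, Function.comp_apply, shift_update_eq, shift, sub_add_cancel]

/-- `∂_{p_x}(f ∘ τ) = (∂_{p_{x-1}} f) ∘ τ`. [folklore] -/
theorem partialPZ_comp_shift_apply (x : ℤ) (f : ChainConfig → ℝ) (σ : ChainConfig) :
    partialPZ x (f ∘ shift) σ = partialPZ (x - 1) f (shift σ) := by
  simp only [partialPZ, Function.comp_apply, shift_update_eq, shift, sub_add_cancel]

/-- The force is shift covariant: `F_x(τσ) = F_{x+1}(σ)`. [folklore] -/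
theorem force_shift (P : OscillatorChain) (σ : ChainConfig) (x : ℤ) :
    P.force (shift σ) x = P.force σ (x + 1) := by
  simp only [OscillatorChain.force, OscillatorChain.interactionForce, shift]
  rw [show x - 1 + 1 = x + 1 - 1 by ring]

/-- The bond current is shift covariant: `j_x(τσ) = j_{x+1}(σ)`. [folklore] -/
theorem bondCurrentZ_shift (P : OscillatorChain) (σ : ChainConfig) (x : ℤ) :
    P.bondCurrentZ (shift σ) x = P.bondCurrentZ σ (x + 1) := by
  simp only [OscillatorChain.bondCurrentZ, shift]

/-- **Shift covariance of the Liouville operator**: `𝒜(f ∘ τ) = (𝒜f) ∘ τ` (no hypothesis on `f`: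
reindexing `x ↦ x - 1` of the lattice sum). [folklore] -/
theorem liouvilleZ_comp_shift (P : OscillatorChain) (f : ChainConfig → ℝ) (σ : ChainConfig) :
    liouvilleZ P (f ∘ shift) σ = liouvilleZ P f (shift σ) := by
  unfold liouvilleZ
  simp only [partialQZ_comp_shift_apply, partialPZ_comp_shift_apply]
  rw [← (Equiv.subRight (1 : ℤ)).tsum_eq (fun y =>
    (shift σ y).2 * partialQZ y f (shift σ) + P.force (shift σ) y * partialPZ y f (shift σ))]
  refine tsum_congr fun x => ?_
  simp only [Equiv.subRight_apply, shift, sub_add_cancel, force_shift]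

/-- Shift-invariant measures are invariant under the inverse shift as well. [folklore] -/
theorem IsShiftInvariant.map_shiftEquiv_symm {ν : Measure ChainConfig} (hν : IsShiftInvariant ν) :
    ν.map shiftEquiv.symm = ν := by
  have h : (shiftEquiv.symm : ChainConfig → ChainConfig) ∘ shift = id :=
    funext fun σ => shiftEquiv.symm_apply_apply σ
  calc ν.map shiftEquiv.symm = (ν.map shift).map shiftEquiv.symm := by rw [hν]
    _ = ν.map (shiftEquiv.symm ∘ shift) := Measure.map_map shiftEquiv.symm.measurable shift_measurable
    _ = ν := by rw [h, Measure.map_id]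

/-- Time invariance is preserved by the shift of a measure (the test class is shift stable and
`𝒜` is shift covariant). [folklore] -/
theorem IsTimeInvariant.map_shift {P : OscillatorChain} {ν : Measure ChainConfig}
    (h : IsTimeInvariant P ν) : IsTimeInvariant P (ν.map shift) := by
  intro f hf
  obtain ⟨hint, hzero⟩ := h (f ∘ shift) hf.comp_shift
  have key : liouvilleZ P (f ∘ shift) = liouvilleZ P f ∘ shift := funext (liouvilleZ_comp_shift P f)
  rw [key] at hint hzero
  refine ⟨?_, ?_⟩
  · rw [← coe_shiftEquiv, integrable_map_equiv shiftEquiv]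
    exact hint
  · rw [← coe_shiftEquiv, integral_map_equiv shiftEquiv]
    exact hzero

/-! ### Momentum-reversal calculus -/

/-- `R` conjugates site updates: `R(σ[x ↦ (q, p)]) = (Rσ)[x ↦ (q, -p)]`. [folklore] -/
theorem momentumReversalZ_update (σ : ChainConfig) (x : ℤ) (v : ℝ × ℝ) :
    momentumReversalZ (Function.update σ x v) = Function.update (momentumReversalZ σ) x (v.1, -v.2) := by
  funext y
  by_cases hy : y = x
  · subst hy; simp
  · simp [Function.update_of_ne hy]

/-- `R` commutes with the shift. [folklore] -/
theorem shift_momentumReversalZ (σ : ChainConfig) :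
    shift (momentumReversalZ σ) = momentumReversalZ (shift σ) := by
  funext x; simp [shift]

/-- The force depends on positions only: `F_x(Rσ) = F_x(σ)`. [folklore] -/
@[simp] theorem force_momentumReversalZ (P : OscillatorChain) (σ : ChainConfig) (x : ℤ) :
    P.force (momentumReversalZ σ) x = P.force σ x := by
  simp [OscillatorChain.force, OscillatorChain.interactionForce]

/-- Kinetic energies are even: `p_x(Rσ)² = p_x(σ)²`. [folklore] -/
@[simp] theorem sq_momentum_momentumReversalZ (σ : ChainConfig) (x : ℤ) :
    (momentumReversalZ σ x).2 ^ 2 = (σ x).2 ^ 2 := by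
  simp

/-- The site energies are even under `R`. [folklore] -/
@[simp] theorem siteEnergy_momentumReversalZ (P : OscillatorChain) (K : ℝ) (σ : ChainConfig) (i : ℤ) :
    P.siteEnergy K (momentumReversalZ σ) i = P.siteEnergy K σ i := by
  simp [OscillatorChain.siteEnergy]

/-- **The bond current is odd under momentum reversal**: `j_x(Rσ) = -j_x(σ)`.
[cite: BonettoLebowitzReyBellet2000, §5.2 eq. (23)] -/
@[simp] theorem bondCurrentZ_momentumReversalZ (P : OscillatorChain) (σ : ChainConfig) (x : ℤ) :
    P.bondCurrentZ (momentumReversalZ σ) x = -P.bondCurrentZ σ x := by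
  simp only [OscillatorChain.bondCurrentZ, momentumReversalZ_apply]
  ring

/-- `∂_{q_x}(f ∘ R) = (∂_{q_x} f) ∘ R`. [folklore] -/
theorem partialQZ_comp_momentumReversalZ (x : ℤ) (f : ChainConfig → ℝ) (σ : ChainConfig) :
    partialQZ x (f ∘ momentumReversalZ) σ = partialQZ x f (momentumReversalZ σ) := by
  simp only [partialQZ, Function.comp_apply, momentumReversalZ_update, momentumReversalZ_apply]

/-- `∂_{p_x}(f ∘ R) = -(∂_{p_x} f) ∘ R` (chain rule along `t ↦ -t`, no differentiability needed).
[folklore] -/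
theorem partialPZ_comp_momentumReversalZ (x : ℤ) (f : ChainConfig → ℝ) (σ : ChainConfig) :
    partialPZ x (f ∘ momentumReversalZ) σ = -partialPZ x f (momentumReversalZ σ) := by
  simp only [partialPZ, Function.comp_apply, momentumReversalZ_update, momentumReversalZ_apply]
  rw [← deriv_comp_neg]

/-- **Momentum reversal anti-commutes with the Liouville operator**: `𝒜(f ∘ R) = -(𝒜f) ∘ R` for
EVERY `f` (termwise: `p_x ∂_{q_x}` changes sign through `p_x`, `F_x ∂_{p_x}` through `∂_{p_x}`).
This is the time-reversal symmetry of the Hamiltonian chain. [folklore] -/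
theorem liouvilleZ_comp_momentumReversalZ (P : OscillatorChain) (f : ChainConfig → ℝ) (σ : ChainConfig) :
    liouvilleZ P (f ∘ momentumReversalZ) σ = -liouvilleZ P f (momentumReversalZ σ) := by
  unfold liouvilleZ
  rw [← tsum_neg]
  refine tsum_congr fun x => ?_
  rw [partialQZ_comp_momentumReversalZ, partialPZ_comp_momentumReversalZ, force_momentumReversalZ,
    momentumReversalZ_apply]
  ring

/-- Function-level form of `liouvilleZ_comp_momentumReversalZ`. [folklore] -/
theorem liouvilleZ_comp_momentumReversalZ' (P : OscillatorChain) (f : ChainConfig → ℝ) :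
    liouvilleZ P (f ∘ momentumReversalZ) = fun σ => -liouvilleZ P f (momentumReversalZ σ) :=
  funext (liouvilleZ_comp_momentumReversalZ P f)

/-- Shift invariance is preserved by `ν ↦ ν ∘ R⁻¹` (`R` commutes with the shift). [folklore] -/
theorem IsShiftInvariant.map_momentumReversalZ {ν : Measure ChainConfig} (hν : IsShiftInvariant ν) :
    IsShiftInvariant (ν.map momentumReversalZ) := by
  unfold IsShiftInvariant at hν ⊢
  rw [Measure.map_map shift_measurable momentumReversalZ.measurable]
  have : shift ∘ (momentumReversalZ : ChainConfig → ChainConfig) = momentumReversalZ ∘ shift :=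
    funext shift_momentumReversalZ
  rw [this, ← Measure.map_map momentumReversalZ.measurable shift_measurable, hν]

/-- **Time invariance is preserved by momentum reversal of the measure**: if `∫ 𝒜f dν = 0` on
`C₀¹` then the same holds for `ν ∘ R⁻¹` (apply the hypothesis to `f ∘ R ∈ C₀¹` and use
`𝒜(f ∘ R) = -(𝒜f) ∘ R`). [folklore] -/
theorem IsTimeInvariant.map_momentumReversalZ {P : OscillatorChain} {ν : Measure ChainConfig}
    (h : IsTimeInvariant P ν) : IsTimeInvariant P (ν.map momentumReversalZ) := by
  intro f hf
  obtain ⟨hint, hzero⟩ := h (f ∘ momentumReversalZ) hf.comp_momentumReversalZ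
  rw [liouvilleZ_comp_momentumReversalZ'] at hint hzero
  refine ⟨?_, ?_⟩
  · rw [integrable_map_equiv momentumReversalZ]
    simpa [Function.comp_def] using hint.neg
  · rw [integral_map_equiv momentumReversalZ]
    rw [integral_neg, neg_eq_zero] at hzero
    exact hzero

/-! ### Momentum reversal and Gibbs states -/

/-- The chain potential is even in the momenta. [folklore] -/
@[simp] theorem chainPotential_momentumReversalZ (P : OscillatorChain) (A : Finset ℤ) (σ : ChainConfig) :
    P.chainPotential A (momentumReversalZ σ) = P.chainPotential A σ := by
  simp [OscillatorChain.chainPotential]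

/-- The finite-volume Hamiltonians of the chain are even in the momenta. [folklore] -/
@[simp] theorem hamiltonianIn_chainPotential_momentumReversalZ (P : OscillatorChain) (Λ : Finset ℤ)
    (σ : ChainConfig) :
    hamiltonianIn P.chainPotential OscillatorChain.chainSupp Λ (momentumReversalZ σ) =
      hamiltonianIn P.chainPotential OscillatorChain.chainSupp Λ σ := by
  unfold hamiltonianIn
  exact Finset.sum_congr rfl fun A _ => chainPotential_momentumReversalZ P A σ

/-- Tilting by a momentum-even density commutes with momentum reversal:
`(μ.tilted f).map R = (μ.map R).tilted f` when `f ∘ R = f` — no measurability of `f` needed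
(change of variables along the measurable equivalence `R`; the generic statement for any
measurable equivalence is `Literature.MathematicalPhysics.QuantumLattice.tilted_map_of_measurableEquiv`,
not imported to keep the cone of this module small). [folklore] -/
theorem map_tilted_momentumReversalZ (μ : Measure ChainConfig) (f : ChainConfig → ℝ)
    (hf : ∀ σ, f (momentumReversalZ σ) = f σ) :
    (μ.tilted f).map momentumReversalZ = (μ.map momentumReversalZ).tilted f := by
  ext s hs
  rw [Measure.map_apply momentumReversalZ.measurable hs,
    tilted_apply' _ _ (momentumReversalZ.measurable hs), tilted_apply' _ _ hs, integral_map_equiv,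
    Measure.restrict_map momentumReversalZ.measurable hs, lintegral_map_equiv]
  simp only [hf]

/-- `R` acts on glued configurations by reversing the momenta of the inside and of the boundary
condition separately. [folklore] -/
theorem momentumReversalZ_glueWith (Λ : Finset ℤ) (ζ : Λ → ℝ × ℝ) (η : ChainConfig) :
    momentumReversalZ (glueWith Λ ζ η) =
      glueWith Λ (fun i => ((ζ i).1, -(ζ i).2)) (momentumReversalZ η) := by
  funext x
  by_cases hx : x ∈ Λ
  · simp [glueWith_apply_mem _ _ _ hx]
  · simp [glueWith_apply_not_mem _ _ _ hx]

/-- Momentum reversal of a finite box preserves the product Lebesgue measure. [folklore] -/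
theorem measurePreserving_boxReversal (Λ : Finset ℤ) :
    MeasurePreserving (fun (ζ : Λ → ℝ × ℝ) (i : Λ) => ((ζ i).1, -(ζ i).2))
      (Measure.pi fun _ : Λ => (volume : Measure (ℝ × ℝ))) (Measure.pi fun _ => volume) := by
  have hneg : MeasurePreserving (Neg.neg : ℝ → ℝ) volume volume := by
    refine ⟨measurable_neg, ?_⟩
    have h := Real.map_volume_mul_left (a := (-1 : ℝ)) (by norm_num)
    have hfun : (fun x : ℝ => -1 * x) = Neg.neg := funext fun x => neg_one_mul x
    rw [hfun] at h
    rw [h]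
    simp
  have h1 : MeasurePreserving (Prod.map id Neg.neg : ℝ × ℝ → ℝ × ℝ) volume volume :=
    (MeasurePreserving.id (volume : Measure ℝ)).prod hneg
  have := measurePreserving_pi (fun _ : Λ => (volume : Measure (ℝ × ℝ))) (fun _ => volume)
    (f := fun _ => Prod.map id Neg.neg) fun _ => h1
  exact this

/-- **Equivariance of the finite-volume Gibbs distributions under momentum reversal**:
`γ_Λ(· | Rη) = γ_Λ(· | η) ∘ R⁻¹` for every volume, boundary condition and temperature
(`H_Λ ∘ R = H_Λ`, `R` preserves `∏ dq dp`). [folklore] -/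
theorem chainSpecification_momentumReversalZ (P : OscillatorChain) (T : ℝ) (Λ : Finset ℤ)
    (η : ChainConfig) :
    P.chainSpecification T Λ (momentumReversalZ η) =
      (P.chainSpecification T Λ η).map momentumReversalZ := by
  simp only [OscillatorChain.chainSpecification, gibbsSpecOfPotential]
  rw [map_tilted_momentumReversalZ _ _ (fun σ => by
    simp only [hamiltonianIn_chainPotential_momentumReversalZ])]
  congr 1
  rw [Measure.map_map momentumReversalZ.measurable (measurable_glueWith Λ η)]
  have hcomp : ((momentumReversalZ : ChainConfig → ChainConfig) ∘ fun ζ : Λ → ℝ × ℝ => glueWith Λ ζ η) =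
      (fun ζ : Λ → ℝ × ℝ => glueWith Λ ζ (momentumReversalZ η)) ∘
        fun (ζ : Λ → ℝ × ℝ) (i : Λ) => ((ζ i).1, -(ζ i).2) := by
    funext ζ
    exact momentumReversalZ_glueWith Λ ζ η
  rw [hcomp, ← Measure.map_map (measurable_glueWith Λ _) (measurePreserving_boxReversal Λ).measurable,
    (measurePreserving_boxReversal Λ).map_eq]

/-- **Momentum reversal maps Gibbs states to Gibbs states**: if `μ` is a DLR state of the chain
`P` at temperature `T`, so is `μ ∘ R⁻¹`. [folklore] -/
theorem _root_.Literature.MathematicalPhysics.KineticTheory.HeatConduction.OscillatorChain.IsChainGibbsMeasure.map_momentumReversalZ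
    {P : OscillatorChain} {T : ℝ} {μ : Measure ChainConfig} (h : P.IsChainGibbsMeasure T μ) :
    P.IsChainGibbsMeasure T (μ.map momentumReversalZ) := by
  obtain ⟨hprob, hDLR⟩ := h
  refine ⟨Measure.isProbabilityMeasure_map momentumReversalZ.measurable.aemeasurable, fun Λ A hA => ?_⟩
  rw [lintegral_map_equiv, MeasurableEquiv.map_apply]
  simp_rw [chainSpecification_momentumReversalZ, MeasurableEquiv.map_apply]
  exact hDLR Λ _ (momentumReversalZ.measurable hA)

/-- Gibbs mixtures are mapped to Gibbs mixtures by momentum reversal. [folklore] -/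
theorem IsGibbsMixture.map_momentumReversalZ {P : OscillatorChain} {ν : Measure ChainConfig}
    (h : IsGibbsMixture P ν) : IsGibbsMixture P (ν.map momentumReversalZ) := by
  obtain ⟨π, κ, hπ, hκ, hae, rfl⟩ := h
  refine ⟨π, fun T => (κ T).map momentumReversalZ, hπ, ?_, ?_, ?_⟩
  · exact (Measure.measurable_map _ momentumReversalZ.measurable).comp hκ
  · exact hae.mono fun T hT => ⟨hT.1, hT.2.map_momentumReversalZ⟩
  · calc (π.bind κ).map momentumReversalZ
          = (π.bind κ).bind fun σ => Measure.dirac (momentumReversalZ σ) :=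
            (Measure.bind_dirac_eq_map _ momentumReversalZ.measurable).symm
      _ = π.bind fun T => (κ T).bind fun σ => Measure.dirac (momentumReversalZ σ) :=
            Measure.bind_bind hκ.aemeasurable
              (Measure.measurable_dirac.comp momentumReversalZ.measurable).aemeasurable
      _ = π.bind fun T => (κ T).map momentumReversalZ := by
            congr 1
            funext T
            exact Measure.bind_dirac_eq_map _ momentumReversalZ.measurable


/-! ### Regularity is preserved by momentum reversal -/

/-- **The Kullback–Leibler divergence is invariant under measurable equivalences**:
`H(μ ∘ e⁻¹ | ν ∘ e⁻¹) = H(μ | ν)` for finite measures (the Radon–Nikodym derivative is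
transported, Mathlib `MeasurableEmbedding.rnDeriv_map`; integrals by change of variables).
[folklore] -/
theorem klDiv_map_equiv {α β : Type*} [MeasurableSpace α] [MeasurableSpace β] (e : α ≃ᵐ β)
    (μ ν : Measure α) [IsFiniteMeasure μ] [IsFiniteMeasure ν] :
    klDiv (μ.map e) (ν.map e) = klDiv μ ν := by
  by_cases hac : μ ≪ ν
  · have hac' : μ.map e ≪ ν.map e := hac.map e.measurable
    -- the log-likelihood ratio is transported along `e`
    have hllr : (llr (μ.map e) (ν.map e)) ∘ e =ᵐ[μ] llr μ ν := by
      have h := e.measurableEmbedding.rnDeriv_map μ ν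
      exact hac.ae_le (h.mono fun x hx => by simp only [Function.comp_apply, llr, hx])
    have hint_iff : Integrable (llr (μ.map e) (ν.map e)) (μ.map e) ↔ Integrable (llr μ ν) μ := by
      rw [integrable_map_equiv e, integrable_congr hllr]
    by_cases hint : Integrable (llr μ ν) μ
    · rw [klDiv_of_ac_of_integrable hac hint, klDiv_of_ac_of_integrable hac' (hint_iff.mpr hint),
        integral_map_equiv e]
      have hI : ∫ x, llr (μ.map e) (ν.map e) (e x) ∂μ = ∫ x, llr μ ν x ∂μ := integral_congr_ae hllr
      rw [hI]
      simp only [Measure.real, MeasurableEquiv.map_apply, Set.preimage_univ]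
    · rw [klDiv_of_not_integrable hint, klDiv_of_not_integrable (fun h => hint (hint_iff.mp h))]
  · have hac' : ¬ μ.map e ≪ ν.map e := by
      intro h
      apply hac
      have h2 := h.map e.symm.measurable
      simpa [Measure.map_map e.symm.measurable e.measurable] using h2
    rw [klDiv_of_not_ac hac, klDiv_of_not_ac hac']

/-- Momentum reversal commutes with box restriction: `(Rσ)|_Λ = R_Λ(σ|_Λ)` with
`R_Λ = Π_Λ (id × neg)` the momentum reversal of the box (a measurable equivalence). [folklore] -/
theorem boxRestrictAt_momentumReversalZ (a : ℤ) (n : ℕ) (σ : ChainConfig) :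
    boxRestrictAt a n (momentumReversalZ σ) =
      (MeasurableEquiv.piCongrRight fun _ : Fin (n + 1) =>
        MeasurableEquiv.prodCongr (MeasurableEquiv.refl ℝ) (MeasurableEquiv.neg ℝ)) (boxRestrictAt a n σ) := by
  funext i; rfl

/-- Box marginals of `ν ∘ R⁻¹` are the box-reversed box marginals of `ν`. [folklore] -/
theorem boxMarginal_map_momentumReversalZ (a : ℤ) (n : ℕ) (ν : Measure ChainConfig) :
    boxMarginal a n (ν.map momentumReversalZ) =
      (boxMarginal a n ν).map (MeasurableEquiv.piCongrRight fun _ : Fin (n + 1) =>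
        MeasurableEquiv.prodCongr (MeasurableEquiv.refl ℝ) (MeasurableEquiv.neg ℝ)) := by
  unfold boxMarginal
  rw [Measure.map_map (boxRestrictAt_measurable a n) momentumReversalZ.measurable,
    Measure.map_map (MeasurableEquiv.measurable _) (boxRestrictAt_measurable a n)]
  rfl

/-- **Regularity is preserved by momentum reversal**: if `ν` is regular (entropy of box marginals
`≤ C|Λ|` relative to a Gibbs state `μ`) then so is `ν ∘ R⁻¹`, relative to the Gibbs state
`μ ∘ R⁻¹` (`IsChainGibbsMeasure.map_momentumReversalZ`), with the same constant (`klDiv` is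
invariant under the box reversal). [folklore] -/
theorem IsRegular.map_momentumReversalZ {P : OscillatorChain} {ν : Measure ChainConfig}
    [IsFiniteMeasure ν] (h : IsRegular P ν) : IsRegular P (ν.map momentumReversalZ) := by
  obtain ⟨T, μ, hT, hμ, C, hC, hbound⟩ := h
  haveI := hμ.isProbabilityMeasure
  refine ⟨T, μ.map momentumReversalZ, hT, hμ.map_momentumReversalZ, C, hC, fun a n => ?_⟩
  rw [boxMarginal_map_momentumReversalZ, boxMarginal_map_momentumReversalZ, klDiv_map_equiv]
  exact hbound a n

/-- **The class of regular space-time invariant probability measures is closed under momentum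
reversal** (and so is the class of Gibbs mixtures): the symmetry `ν ↦ ν ∘ R⁻¹` of Definition 1.
[folklore] -/
theorem spaceTimeInvariantRegular_map_momentumReversalZ {P : OscillatorChain} {ν : Measure ChainConfig}
    (hprob : IsProbabilityMeasure ν) (hshift : IsShiftInvariant ν) (htime : IsTimeInvariant P ν)
    (hreg : IsRegular P ν) :
    IsProbabilityMeasure (ν.map momentumReversalZ) ∧ IsShiftInvariant (ν.map momentumReversalZ) ∧
      IsTimeInvariant P (ν.map momentumReversalZ) ∧ IsRegular P (ν.map momentumReversalZ) :=
  ⟨Measure.isProbabilityMeasure_map momentumReversalZ.measurable.aemeasurable,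
    hshift.map_momentumReversalZ, htime.map_momentumReversalZ, hreg.map_momentumReversalZ⟩

/-! ### Consequences of momentum-reversal invariance of a state -/

/-- **An `R`-invariant measure carries zero mean bond current** (`j_x` is odd under `R`; no
integrability needed, both sides being Bochner junk `0` otherwise). [folklore] -/
theorem integral_bondCurrentZ_eq_zero_of_map_momentumReversalZ_eq (P : OscillatorChain)
    {ν : Measure ChainConfig} (hν : ν.map momentumReversalZ = ν) (x : ℤ) :
    ∫ σ, P.bondCurrentZ σ x ∂ν = 0 := by
  have h := integral_map_equiv momentumReversalZ (fun σ => P.bondCurrentZ σ x) (μ := ν)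
  rw [hν] at h
  simp only [bondCurrentZ_momentumReversalZ, integral_neg] at h
  linarith

/-- **An `R`-invariant measure is stationary on `R`-even observables for free**: if
`ν ∘ R⁻¹ = ν` and `f ∘ R = f` then `∫ 𝒜f dν = 0` (since `(𝒜f) ∘ R = -𝒜(f ∘ R) = -𝒜f`). Time
invariance of an `R`-invariant state is therefore a condition on the `R`-odd test functions only.
[folklore] -/
theorem integral_liouvilleZ_eq_zero_of_map_momentumReversalZ_eq (P : OscillatorChain)
    {ν : Measure ChainConfig} (hν : ν.map momentumReversalZ = ν) {f : ChainConfig → ℝ}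
    (hf : ∀ σ, f (momentumReversalZ σ) = f σ) : ∫ σ, liouvilleZ P f σ ∂ν = 0 := by
  have hfR : f ∘ momentumReversalZ = f := funext hf
  have h := integral_map_equiv momentumReversalZ (liouvilleZ P f) (μ := ν)
  rw [hν] at h
  have hpt : ∀ σ, liouvilleZ P f (momentumReversalZ σ) = -liouvilleZ P f σ := fun σ => by
    have h1 := liouvilleZ_comp_momentumReversalZ P f σ
    rw [hfR] at h1
    linarith
  simp only [hpt, integral_neg] at h
  linarith

end Literature.MathematicalPhysics.KineticTheory.HeatConduction

end
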